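import Summits.ABC.IUTFork.Repair.CandMochizuki7RamE
import Summits.ABC.IUTFork.Thm311MultiradProofs
import HarnessLib

/-!
# IUT REPAIR BRANCH (rung LADDER-ABC:A2.RP) — the director's OBJECT sentence `PilotKummerIndRelated` on the ramified bed RAM_e(p, m)
# with HONEST étale-like splitting monoid: TRUE for every region reading when `e > 4m`, FALSE for the projection reading when `e ≤ 4m`

Record file (D-0012; MODEL DATA `ramDataEH`/`ramSituationEH`/`ramLatticeEH`/`ramSettingEH`/`projRegion` — the bed of `CandMochizuki7RamE` with the
data (b) of every vertical line carrying the HONEST vertically-coric splitting monoid `{(π^{m·j²})_j}` instead of `∅`, so that [IUTchIII]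
Thm. 3.11 (ii) (b) `KummerB` HOLDS (`kummerB_ramEH`, by `rfl`) —, then proof-only cells; no `Prop` fact; nothing asserted about print) of the
abc-iut cell, seat abc-iut-rp-m1 (gen 4; class (ii)). TAKES NO SIDE on [IUTchIII] Cor. 3.12 or on any author; typed ≠ proved.

THE OBJECT (director-abc 2026-08-26T05:11:35Z): «the one non-derivable sentence isolated by the adjudication, `Cor312Vol.PilotKummerIndRelated`
(Cor312PinnedRegionsThreePins.lean:145; inline form `PilotKummerCompat`, Cor312PilotKummerCompat.lean:90)»:
`∀ j v_ℚ, ∃ D′ ∈ ^{n,∘}ℜ^LGP, ρ qK j v_ℚ = ρ D′.Ψ j v_ℚ` — the q-pilot's Kummer datum generates the same `ρ`-region as the splitting monoid of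
SOME (Ind1),(Ind2)-translate of the line-`n` Θ-data.

CELLS (kernel; bed RAM_e(p, m): `K = ℚ_p(π)`, `π^e = p`, Ism = `GL_e(ℤ_(p))` — the Dupuy–Hilado v1 §4.9 reading [cite: DupuyHilado2025, §4.9],
declared STRONGER than print's; `l⋇ = 2`; honest Kummer data Θ ↦ `(π^m, π^{4m})`, q ↦ `(π^m, π^m)`):
* **`pilotKummerIndRelated_ramEH` — for `e > 4m` the OBJECT sentence HOLDS at RAM_e(p, m) FOR EVERY region reading `ρ`**: Thm. 3.11 (ii) (b)
  holds on the bed and the datum-level `PilotKummerCompat` holds (`pilotKummerCompat_ramEH`: the swap family `π^{4m} ↔ π^m` of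
  `CandMochizuki7RamE`), so abc-iut-w5-d068's `pilotKummerIndRelated_of_pilotKummerCompat` applies; with it the typed Corollary, the licence
  and the bridge hypotheses (`ramEH_object_model`);
* **`not_pilotKummerIndRelated_ramEH_proj` — for `e ≤ 4m`, `m ≥ 1`, the OBJECT sentence FAILS for the COORDINATE-PROJECTION reading**
  `projRegion` (`ρ Ψ j v_ℚ :=` the set of `j`-components of the tuples in `Ψ`; it transforms with the data, `projRegion_starAut`): every
  `D′ ∈ ^{0,∘}ℜ^LGP` has `D′.Ψ = Φ·{(π^{m·j²})_j}` for one `Φ ∈ ⟨Ind1∪Ind2⟩` (abc-iut-L6-t13's `MRData.mem_RLGP_iff`), and at label 2 no such `Φ`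
  carries `π^{4m}` to `π^m` (divisibility, `image_piElt_two_ne`).
So on this honest family the director's OBJECT is DECIDED BY THE ARITHMETIC OF THE DATUM, `e > m·(l⋇)²` vs `e ≤ m·(l⋇)²`, exactly as its inline
form. HONEST CAVEAT (as in `CandMochizuki7RamE`): at `v ∈ V^bad` with `l ∤ ord_{F_v}(q_E)`, `e_v = e(F_v/ℚ_p)·l·e′` and `m_v = e′·ord_{F_v}(q_E)/2`
(`e(K_v/F_v) = l·e′`), so with print's `l⋇ = (l−1)/2` the window `e_v > m_v·(l⋇)²` reads `8·l·e(F_v/ℚ_p) > ord_{F_v}(q_E)·(l−1)²`: EMPTY as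
soon as `l ≥ 8·e(F_v/ℚ_p) + 2` (in particular in the regime of [IUTchIV] Cor. 2.2: `l` of the order of the square root of the height,
`[F : ℚ]` bounded), though NOT for small `l` against a highly ramified `F_v` (ERRATUM to this docstring's first version, p461695, which said
«empty for `l ≥ 5`»); the cells say what a DH-sized Ism can do on a toy, nothing about print's data or print's Ism; no repair is claimed.
[claim: Mochizuki2012, status: disputed] [cite: ScholzeStix2018, §2.2 pp. 9–10]
-/

noncomputable section

open Set

namespace Summit.ABC.IUTFork.Repair.CandMochizuki7RamE

open Thm311 Cor312 Cor312.Checks Cor312.IdentifiedNonVacuity Cor312Vol Cor312Vol.NaiveWitness Cor312Vol.PinnedWitness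
  Cor312Vol.RamifiedEWitness Literature.IUT.LogThetaLattice
open Cor312Vol.RamifiedWitness (PLe IsPInt ple_zero isPInt_one fib eq_fib ple_ppow_iff)

variable (p e : ℕ) [NeZero e] [hp : Fact p.Prime] (m : ℕ)

/-! ## 1. The bed with honest étale-like splitting monoid (Thm. 3.11 (ii) (b) holds) -/

/-- **The data (a)(b)(c) of every vertical line, HONEST (b)**: as `ramDataE`, but the vertically-coric splitting monoid's Kummer image at the
bad place is the honest tuple `{(π^{m·j²})_j}` (so that (ii) (b) identifies it with every column-`m′` Frobenius-like image).
[claim: Mochizuki2012, status: disputed] -/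
def ramDataEH : MRData (ramShellsE p e) where
  shellPk := fun j vQ => {x | Integral p e j vQ x}
  shellSub := fun j v => {x | Integral p e j (toyIndex.over v) x}
  Adm := fun j vQ A => (rFrame p e j vQ).IsBounded A ∧ (rFrame p e j vQ).HasHull A
  logvol := fun j vQ A => rVol p e j vQ ((rFrame p e j vQ).hull A)
  Ψ := fun v _ => {thetaTupleE p e m v}
  act := fun _ _ _ => 0
  Mmod := fun _ => ∅

/-- The situation with honest (b). [claim: Mochizuki2012, status: disputed] -/
def ramSituationEH : Situation toyIndex where
  L := ramShellsE p e
  D := fun _ => ramDataEH p e m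
  G := fun _ j => ramDegreesE p e j

/-- **The lattice situation RAM_e^H(p, m)**: honest (b) on every line, the column `ramColumnE` at every `n`. [claim: Mochizuki2012, status: disputed] -/
def ramLatticeEH : LatticeSituation toyIndex where
  toSituation := ramSituationEH p e m
  col := fun _ => ramColumnE p e m

/-- **The Cor. 3.12 setting over RAM_e^H(p, m)**: verbatim the glue of `ramSettingE` (column `0`, frame the polydiscs, Θ-box `box (m·k·j²)`,
q-box `box (m·k)`, honest object side `pinSig`). [claim: Mochizuki2012, status: disputed] -/
def ramSettingEH : Cor312.Setting (ramLatticeEH p e m).toSituation where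
  n := 0
  HT := ℤ × ℤ
  LogLink := fun _ _ => Unit
  IsFull := fun _ => True
  lattice :=
    { theater := fun n m => (n, m)
      distinct := fun p q h => by simpa using h
      logLink := fun _ _ => ()
      logLink_full := fun _ _ => trivial }
  Frd := Unit
  IsoF := fun _ _ => Unit
  Ob := fun _ => ℤ
  realify := id
  Strip := Unit
  IsoS := fun _ _ => Unit
  M := fun _ _ => ExpMonoid
  sig := pinSig
  split := { Msplit := fun _ _ => ⊤, exists_gen := fun _ _ => ⟨⟨gen, trivial⟩, top_gen_isGenerator⟩ }
  ObΔ := ℤ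
  N := fun _ _ => ExpMonoid
  qData :=
    { q := fun _ _ => gen
      q_gen := fun _ _ => gen_isGenerator
      objOf := fun x => (expOf (x () (Set.mem_univ ())) : ℤ) }
  frame := fun j vQ => rFrame p e j vQ
  hul_adm := fun j vQ _ hH => by obtain ⟨k, rfl⟩ := hH; exact rFrame_bounded_hasHull j vQ k
  thetaRegionOf := fun _ k j vQ => box p e j vQ ((m : ℤ) * k * jsq j)
  qRegionOf := fun k j vQ => box p e j vQ (if j = 0 then 0 else (m : ℤ) * k)
  qRegion_mem := fun j vQ => ⟨_, rfl⟩
  qSupport_finite := fun _ => Set.toFinite _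

/-- **[IUTchIII] Thm. 3.11 (ii) (b) `KummerB` HOLDS on RAM_e^H(p, m)** for the column of the setting (every column-`m′` Frobenius-like Kummer
image IS the vertically-coric splitting monoid: both are the honest tuple). [claim: Mochizuki2012, status: disputed] -/
theorem kummerB_ramEH : ((ramLatticeEH p e m).col (ramSettingEH p e m).n).KummerB ((ramLatticeEH p e m).D (ramSettingEH p e m).n) :=
  fun _ _ _ => rfl

/-! ## 2. `e > 4m`: the OBJECT sentence holds for every region reading -/

/-- The datum-level residual on RAM_e^H(p, m), `e > 4m` (the swap family of `CandMochizuki7RamE`). [claim: Mochizuki2012, status: disputed] -/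
theorem pilotKummerCompat_ramEH (h : 4 * m < e) : PilotKummerCompat (ramLatticeEH p e m) (ramSettingEH p e m) (qDatumE p e m) := by
  refine ⟨permFam p e (swapPerm e m h), permFam_mem_closure p e _, 0, fun v _ => ?_⟩
  show ({qTupleE p e m v} : Set _) = (ramShellsE p e).starAut (permFam p e (swapPerm e m h)) v '' {thetaTupleE p e m v}
  rw [Set.image_singleton, starAut_swapFam_thetaTuple]

/-- **THE OBJECT SENTENCE HOLDS: `PilotKummerIndRelated` at RAM_e^H(p, m) for `e > 4m`, for EVERY region reading `ρ`** — the honest q-pilot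
Kummer datum generates the same `ρ`-region as the splitting monoid of the (Ind2)-translate of the line-`0` data by the swap family.
[claim: Mochizuki2012, status: disputed] -/
theorem pilotKummerIndRelated_ramEH (h : 4 * m < e)
    (ρ : (∀ v : toyIndex.V, v ∈ toyIndex.Vbad → Set ((ramShellsE p e).StarPacket v)) →
      ∀ (j : toyIndex.Label) (vQ : toyIndex.VQ), Set ((ramShellsE p e).Packet j vQ)) :
    PilotKummerIndRelated (ramLatticeEH p e m) (ramSettingEH p e m) ρ (qDatumE p e m) :=
  pilotKummerIndRelated_of_pilotKummerCompat _ _ ρ _ (kummerB_ramEH p e m) (pilotKummerCompat_ramEH p e m h)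

/-! ## 3. `e ≤ 4m`: the OBJECT sentence fails for the coordinate-projection reading -/

/-- **The COORDINATE-PROJECTION region reading**: `ρ Ψ j v_ℚ :=` the set of label-`j` components of the star-packet tuples in `Ψ` at the
(unique, bad) place; `∅` at the zero label. [claim: Mochizuki2012, status: disputed] -/
def projRegion (Ψ : ∀ v : toyIndex.V, v ∈ toyIndex.Vbad → Set ((ramShellsE p e).StarPacket v)) (j : toyIndex.Label) (vQ : toyIndex.VQ) :
    Set ((ramShellsE p e).Packet j vQ) :=
  if hj : j = 0 then ∅ else (fun t : (ramShellsE p e).StarPacket vQ => t ⟨j, hj⟩) '' Ψ vQ trivial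

omit [NeZero e] hp in
/-- The projection reading TRANSFORMS WITH THE DATA ((hρ) of PR-1): `ρ(Φ·Ψ) = Φ·ρ(Ψ)`. [folklore] -/
theorem projRegion_starAut (Φ : (ramShellsE p e).PacketAut) (Ψ : ∀ v : toyIndex.V, v ∈ toyIndex.Vbad → Set ((ramShellsE p e).StarPacket v))
    (j : toyIndex.Label) (vQ : toyIndex.VQ) :
    projRegion p e (fun v hv => (ramShellsE p e).starAut Φ v '' Ψ v hv) j vQ = Φ j vQ '' projRegion p e Ψ j vQ := by
  unfold projRegion
  split_ifs with hj
  · rw [Set.image_empty]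
  · rw [Set.image_image, Set.image_image]
    rfl

omit [NeZero e] hp in
/-- The projection of a singleton datum at a nonzero label is the singleton of its component. [folklore] -/
theorem projRegion_singleton {j : toyIndex.Label} (hj : j ≠ 0) (vQ : toyIndex.VQ) (f : ∀ v : toyIndex.V, (ramShellsE p e).StarPacket v) :
    projRegion p e (fun v _ => {f v}) j vQ = {f vQ ⟨j, hj⟩} := by
  unfold projRegion
  rw [dif_neg hj]
  exact Set.image_singleton

/-- At label `2` no element of ⟨(Ind1)∪(Ind2)⟩ carries the Θ-entry `π^{4m}` to the q-entry `π^m` once `e ≤ 4m`, `m ≥ 1` (divisibility: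
`π^{4m} ∈ p^{⌊4m/e⌋}·𝕀` is preserved, `⌊4m/e⌋ > ⌊m/e⌋`). [folklore] -/
theorem image_piElt_two_ne (hm : 1 ≤ m) (h : e ≤ 4 * m) {Φ : (ramShellsE p e).PacketAut} (hΦ : Φ ∈ indG p e) (vQ : toyIndex.VQ) :
    Φ 2 vQ (piEltE p e 2 vQ ((m : ℤ) * jsq 2)) ≠ piEltE p e 2 vQ m := fun h2 => by
  have hj : jsq (2 : toyIndex.Label) = 4 := rfl
  rw [hj] at h2
  have hdiv := ple_coord_image_piEltE p e hΦ 2 vQ ((m : ℤ) * 4) (lastIdx e 2 (resFin e m))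
  rw [h2, coord_piEltE_self, ple_ppow_iff] at hdiv
  have he := e_pos e
  have h3 := Int.mul_ediv_add_emod (m : ℤ) e
  have h3' := Int.emod_nonneg (m : ℤ) he.ne'
  have h5 : (e : ℤ) ≤ 4 * m := by exact_mod_cast h
  have key : (m : ℤ) / e + 1 ≤ (m : ℤ) * 4 / e := by
    apply Int.le_ediv_of_mul_le he
    rcases lt_or_ge (m : ℤ) e with hlt | hle
    · rw [Int.ediv_eq_zero_of_lt (by positivity) hlt]; omega
    · rw [add_mul, one_mul, mul_comm]; omega
  omega

/-- **THE OBJECT SENTENCE FAILS: `¬ PilotKummerIndRelated` at RAM_e^H(p, m) for the projection reading, `e ≤ 4m`, `m ≥ 1`.**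
[claim: Mochizuki2012, status: disputed] -/
theorem not_pilotKummerIndRelated_ramEH_proj (hm : 1 ≤ m) (h : e ≤ 4 * m) :
    ¬ PilotKummerIndRelated (ramLatticeEH p e m) (ramSettingEH p e m) (projRegion p e) (qDatumE p e m) := fun H => by
  obtain ⟨D', hD', hEq⟩ := H 2 ()
  obtain ⟨Φ, hΦ, rfl⟩ := (MRData.mem_RLGP_iff _ D').1 hD'
  have h2 : (2 : toyIndex.Label) ≠ 0 := by decide
  have hL : projRegion p e (qDatumE p e m) 2 () = {qTupleE p e m () ⟨2, h2⟩} := projRegion_singleton p e h2 () (qTupleE p e m)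
  have hR : projRegion p e (((ramLatticeEH p e m).D (ramSettingEH p e m).n).map Φ).Ψ 2 () =
      {((ramShellsE p e).starAut Φ () (thetaTupleE p e m ())) ⟨2, h2⟩} := by
    show projRegion p e (fun v hv => (ramShellsE p e).starAut Φ v '' {thetaTupleE p e m v}) 2 () = _
    rw [projRegion_starAut, projRegion_singleton p e h2 () (thetaTupleE p e m)]
    exact Set.image_singleton
  have key : qTupleE p e m () ⟨2, h2⟩ ∈ projRegion p e (((ramLatticeEH p e m).D (ramSettingEH p e m).n).map Φ).Ψ 2 () := by
    rw [← hEq, hL]; exact Set.mem_singleton _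
  rw [hR] at key
  have key' := Set.mem_singleton_iff.1 key
  change piEltE p e 2 () m = Φ 2 () (piEltE p e 2 () ((m : ℤ) * jsq 2)) at key'
  exact image_piElt_two_ne p e m hm h hΦ () key'.symm

/-! ## 4. The OBJECT decided by the datum; the model packaged -/

/-- The hull, the two printed quantities and the Statement of RAM_e^H(p, m) are those of RAM_e(p, m) (the glue does not read (b)):
the typed Corollary holds for `m ≤ e − 1`. [folklore] -/
theorem ramSettingEH_statement_of_le (h : m + 1 ≤ e) : (ramSettingEH p e m).Statement :=
  ramSettingE_statement_of_le p e m h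

/-- The licence on RAM_e^H(p, m) for `3m ≤ 2(e−1)`. [folklore] -/
theorem ramSettingEH_licence_of_le (h : 3 * (m : ℤ) ≤ 2 * ((e : ℤ) - 1)) : Thm311ToCor312.Licence (ramSettingEH p e m) :=
  ramSettingE_licence_of_le p e m h

/-- The bridge hypotheses on RAM_e^H(p, m) (those of RAM_e(p, m), field by field). [folklore] -/
theorem ramSettingEH_bridgeHyps : BridgeHyps (ramSettingEH p e m) :=
  have h := ramSettingE_bridgeHyps p e m
  { mono := h.mono, image_adm := h.image_adm, image_fin := h.image_fin, hul_nonempty := h.hul_nonempty,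
    theta_nonempty := h.theta_nonempty, finite := h.finite }

/-- **THE OBJECT'S MODEL (`e > 4m ≥ 4`)**: on RAM_e^H(p, m) Thm. 3.11 (ii) (b) holds, the bridge hypotheses hold, `|log(q)| > 0`, and the OBJECT
sentence `PilotKummerIndRelated` holds for EVERY region reading — together with the typed Corollary and the licence. A toy (`l⋇ = 2`,
Dupuy–Hilado Ism); no repair is claimed. [claim: Mochizuki2012, status: disputed] -/
theorem ramEH_object_model (hm : 1 ≤ m) (h : 4 * m < e)
    (ρ : (∀ v : toyIndex.V, v ∈ toyIndex.Vbad → Set ((ramShellsE p e).StarPacket v)) →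
      ∀ (j : toyIndex.Label) (vQ : toyIndex.VQ), Set ((ramShellsE p e).Packet j vQ)) :
    ((ramLatticeEH p e m).col (ramSettingEH p e m).n).KummerB ((ramLatticeEH p e m).D (ramSettingEH p e m).n) ∧
      BridgeHyps (ramSettingEH p e m) ∧ (ramSettingEH p e m).AbsLogQPos ∧
      PilotKummerIndRelated (ramLatticeEH p e m) (ramSettingEH p e m) ρ (qDatumE p e m) ∧
      (ramSettingEH p e m).Statement ∧ Thm311ToCor312.Licence (ramSettingEH p e m) :=
  ⟨kummerB_ramEH p e m, ramSettingEH_bridgeHyps p e m, ramSettingE_absLogQPos p e m hm, pilotKummerIndRelated_ramEH p e m h ρ,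
    ramSettingEH_statement_of_le p e m (by omega), ramSettingEH_licence_of_le p e m (by omega)⟩

/-- **THE OBJECT DECIDED BY THE DATUM** (`m ≥ 1`, projection reading): `PilotKummerIndRelated` at RAM_e^H(p, m) ⟺ `e > 4m`.
[claim: Mochizuki2012, status: disputed] -/
theorem pilotKummerIndRelated_ramEH_proj_iff (hm : 1 ≤ m) :
    PilotKummerIndRelated (ramLatticeEH p e m) (ramSettingEH p e m) (projRegion p e) (qDatumE p e m) ↔ 4 * m < e := by
  refine ⟨fun H => ?_, fun h => pilotKummerIndRelated_ramEH p e m h _⟩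
  by_contra h
  exact not_pilotKummerIndRelated_ramEH_proj p e m hm (Nat.le_of_not_lt h) H

end Summit.ABC.IUTFork.Repair.CandMochizuki7RamE

end
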